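/-
Copyright (c) 2026. All rights reserved.
Released under Apache 2.0 license as described in the file LICENSE.
-/
import Mathlib
import HarnessLib
import Literature.MathematicalPhysics.QuantumFieldTheory.ConstructiveQFTWave0
import Literature.MathematicalPhysics.QuantumLattice.YangMillsClassical
import Summits.Ventures.LatticeQCDFlow.Scaling.SpecialUnitarySmallBall
import Summits.Ventures.LatticeQCDFlow.Scaling.LatticeEntropySUN
import Summits.Ventures.LatticeQCDFlow.Scaling.MDTunnellingLaw
import Summits.Ventures.LatticeQCDFlow.Exactness.InvolutiveMetropolis
import Summits.Ventures.LatticeQCDFlow.Exactness.MomentumRefresh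

/-!
# The `SU(N)` momentum collar: an MD drift that changes the `ε`-sector starts near the defect, and
# the `SU(N)` HMC SECTOR TUNNELLING LAW (lean-1 GEN-7, own work)

HONEST FRAMING: exact (Metropolis-corrected) sampling algorithms for lattice gauge theory;
figures of merit are autocorrelation/cost numbers at stated couplings and volumes; no
continuum-physics claim.

Venture `LatticeQCDFlow` (cell pub-lqcd), topic `Scaling`, FANOUT row 30 (lean-1).  NEW WORK of the
cell; nothing here is cited as a fact.  Gauge group `SU(N)` (`Matrix.specialUnitaryGroup (Fin N) ℂ`
with the Hilbert–Schmidt = Frobenius distance of the tree), lattice `(ℤ/L)^d`, every `N`, `d`, `L`.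

theory2's v4.3 (items 116a–c, `Scaling/MDTunnellingLaw`, `MDFluxTunnelling`, `MDLeapfrog`) proved
the HMC / molecular-dynamics FLUX tunnelling law for compact `U(1)`: the abelian drift rotates every
plaquette rigidly, so a drift that changes the plane flux starts in a momentum-proportional COLLAR
of the cut; THEORY-2.md §0 gen-24 (7) records the non-abelian case as NOT TYPED ("the drift collar
needs the nonabelian plaquette velocity").  This file types it, charge-free, in Lüscher's `ε`-sector
language of `Scaling/MetricTunnellingSectors` (sectors := connected components of an admissible
region `A`):
* §1 `norm_exp_smul_sub_exp_smul_le`: one-parameter unitary subgroups have Hilbert–Schmidt speed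
  `‖X‖` — `‖exp(tX) − exp(sX)‖ ≤ (t − s)‖X‖` for skew-Hermitian `X` (mean value inequality + left
  unitary invariance of the Frobenius norm, `Matrix.frobenius_norm_unitaryGroup_mul`);
* §2 `dist_mul_mul_le`, `dist_inv_inv_eq`, `dist_plaquetteHolonomy_le`: products and inverses in
  `SU(N)` are `1`-Lipschitz in each factor, hence a plaquette moves by at most the sum of the
  displacements of its four links;
* §3 THE `SU(N)` MD DRIFT `drift t ϖ U = (e ↦ exp(t·ϖ_e)·U_e)` (`ϖ : E → 𝔰𝔲(N)`, the tree's chart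
  `SUN.suChart`): `dist_drift_apply_le` (each link moves by `≤ |t|‖ϖ_e‖`),
  `dist_plaquetteHolonomy_drift_le` (each plaquette by `≤ |t|·Σ_{e∈∂p}‖ϖ_e‖` — the non-abelian
  plaquette velocity bound), and **`exists_plaquette_near_defect_of_sector_ne`**: if `A` contains
  every configuration all of whose plaquettes are within `ε` of `1` and the drift for time `δ`
  changes the connected component of `A`, then at the START some plaquette `p` has
  `dist (U_p) 1 ≥ ε − |δ|·Σ_{e∈∂p}‖ϖ_e‖` (the segment `t ↦ drift (tδ) ϖ U` is connected, so it must
  leave `A`);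
* §4 **`sun_hmc_sectorCharge_ne_le_sum`** — THE `SU(N)` HMC SECTOR TUNNELLING LAW: for the kernel of
  `Exactness/MomentumRefresh.hmc_config_exact` verbatim (target `e^{−S}volU` on `SU(N)^E`, momenta
  on any measurable space `M` with kinetic term `T`, `0 < Z_T < ∞`, proposal `flip ∘ nodes step n`
  with volume-preserving steps whose configuration component is such a drift by a measurable
  momentum field, Metropolis on `H = S + T`), for every measurable observable `Q` that is CONSTANT ON
  THE SECTORS of `A` and every `h : ℝ`:
  `(e^{−S}volU ⊗ K){Q ≠ Q'} ≤ Z_T⁻¹ Σ_{k<n} (e^{h}·B{z | ∃ p, ε − |δ_k|Σ_{e∈∂p}‖(g_k z)_e‖ ≤ dist((z.1)_p, 1)} + B{ΔH_k > h})`,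
  `B = e^{−(S+T)}(volU ⊗ volP)` — theory2's abstract law `Tunnelling.MD.hmc_chargeNe_le_sum` (item
  116a) with the collar of §3.  Value-free reading: per update at stationarity, an `SU(N)` HMC
  kernel changes the `ε`-sector at most as often as some leapfrog node has a plaquette within its
  momentum margin of the admissibility cut (×`e^{h}`) or violates energy by more than `h`.
NOT CLAIMED: any estimate of the collar masses or `ΔH` tails (inputs); an `SU(N)` leapfrog instance
(the tree's `Exactness/SplittingIntegrator` instance is typed for `U(1)` in item 116c); Lüscher's
theorem labelling sectors by an integer charge (any sector-constant measurable `Q` is allowed).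
One `def` (`SUN.drift`); no `sorry`; standard axioms only.
-/

noncomputable section

open scoped Matrix.Norms.Frobenius Matrix ENNReal
open MeasureTheory Metric Set Filter Topology NormedSpace ProbabilityTheory
open Literature.MathematicalPhysics.QuantumFieldTheory
open Literature.MathematicalPhysics.QuantumFieldTheory.UnitaryCayley (𝔼 skewOf conjTranspose_skewOf)
open Summit.Ventures.LatticeQCDFlow.Exactness
open Summit.Ventures.LatticeQCDFlow.Theory2.Tunnelling

namespace Summit.Ventures.LatticeQCDFlow.Theory2.Lattice.SUN

variable {N : ℕ}

/-! ## §1 Speed of one-parameter unitary subgroups (Hilbert–Schmidt norm) -/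

/-- `exp(sX)` is unitary for skew-Hermitian `X` and real `s`. [folklore] -/
theorem exp_smul_mem_unitaryGroup {X : Matrix (Fin N) (Fin N) ℂ} (hX : Xᴴ = -X) (s : ℝ) :
    exp (s • X) ∈ Matrix.unitaryGroup (Fin N) ℂ :=
  exp_mem_unitary_of_mem_skewAdjoint (by
    rw [skewAdjoint.mem_iff, star_smul, star_trivial, Matrix.star_eq_conjTranspose, hX, smul_neg])

/-- **Geodesic speed**: for skew-Hermitian `X` and real `s ≤ t`,
`‖exp(tX) − exp(sX)‖ ≤ (t − s)·‖X‖` (the derivative `exp(uX)·X` has norm `‖X‖` by left unitary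
invariance of the Hilbert–Schmidt norm). [folklore] -/
theorem norm_exp_smul_sub_exp_smul_le {X : Matrix (Fin N) (Fin N) ℂ} (hX : Xᴴ = -X) {s t : ℝ}
    (hst : s ≤ t) : ‖exp (t • X) - exp (s • X)‖ ≤ (t - s) * ‖X‖ := by
  have hd : ∀ u ∈ Icc s t,
      HasDerivWithinAt (fun u : ℝ => exp (u • X)) (exp (u • X) * X) (Icc s t) u :=
    fun u _ => (hasDerivAt_exp_smul_const (𝕂 := ℝ) X u).hasDerivWithinAt
  have hb : ∀ u ∈ Ico s t, ‖exp (u • X) * X‖ ≤ ‖X‖ := fun u _ =>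
    le_of_eq (Matrix.frobenius_norm_unitaryGroup_mul ⟨exp (u • X), exp_smul_mem_unitaryGroup hX u⟩ X)
  have h := norm_image_sub_le_of_norm_deriv_le_segment' hd hb t (right_mem_Icc.2 hst)
  linarith [h]

/-- `‖exp(tX) − 1‖ ≤ |t|·‖X‖` for skew-Hermitian `X`. [folklore] -/
theorem norm_exp_smul_sub_one_le_abs_mul {X : Matrix (Fin N) (Fin N) ℂ} (hX : Xᴴ = -X) (t : ℝ) :
    ‖exp (t • X) - 1‖ ≤ |t| * ‖X‖ := by
  rcases le_total 0 t with ht | ht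
  · have h := norm_exp_smul_sub_exp_smul_le hX ht
    rw [zero_smul, exp_zero, sub_zero] at h
    rw [abs_of_nonneg ht]; exact h
  · have h := norm_exp_smul_sub_exp_smul_le hX ht
    rw [zero_smul, exp_zero, zero_sub] at h
    rw [abs_of_nonpos ht, ← norm_neg, neg_sub]
    linarith [h]

/-! ## §2 Products and inverses are `1`-Lipschitz in each factor (Hilbert–Schmidt metric) -/

/-- `dist (A B) (A' B') ≤ dist A A' + dist B B'` on `SU(N)`. [folklore] -/
theorem dist_mul_mul_le (A B A' B' : (Matrix.specialUnitaryGroup (Fin N) ℂ)) : dist (A * B) (A' * B') ≤ dist A A' + dist B B' := by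
  have hA : (A : Matrix (Fin N) (Fin N) ℂ) ∈ Matrix.unitaryGroup (Fin N) ℂ :=
    Matrix.specialUnitaryGroup_le_unitaryGroup A.2
  have hB' : (B' : Matrix (Fin N) (Fin N) ℂ) ∈ Matrix.unitaryGroup (Fin N) ℂ :=
    Matrix.specialUnitaryGroup_le_unitaryGroup B'.2
  rw [Subtype.dist_eq, Subtype.dist_eq, Subtype.dist_eq, dist_eq_norm, dist_eq_norm, dist_eq_norm]
  have e : ((A * B : (Matrix.specialUnitaryGroup (Fin N) ℂ)) : Matrix (Fin N) (Fin N) ℂ) - ((A' * B' : (Matrix.specialUnitaryGroup (Fin N) ℂ)) : Matrix (Fin N) (Fin N) ℂ) =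
      ((⟨(A : Matrix (Fin N) (Fin N) ℂ), hA⟩ : Matrix.unitaryGroup (Fin N) ℂ) : Matrix (Fin N) (Fin N) ℂ) *
          ((B : Matrix (Fin N) (Fin N) ℂ) - B') +
        ((A : Matrix (Fin N) (Fin N) ℂ) - A') *
          ((⟨(B' : Matrix (Fin N) (Fin N) ℂ), hB'⟩ : Matrix.unitaryGroup (Fin N) ℂ) :
            Matrix (Fin N) (Fin N) ℂ) := by
    show (A : Matrix (Fin N) (Fin N) ℂ) * B - A' * B' = A * (B - B') + (A - A') * B'
    rw [Matrix.mul_sub, Matrix.sub_mul]; abel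
  rw [e]
  refine (norm_add_le _ _).trans ?_
  rw [Matrix.frobenius_norm_unitaryGroup_mul, Matrix.frobenius_norm_mul_unitaryGroup, add_comm]

/-- `dist A⁻¹ A'⁻¹ = dist A A'` on `SU(N)` (inversion is the conjugate transpose). [folklore] -/
theorem dist_inv_inv_eq (A A' : (Matrix.specialUnitaryGroup (Fin N) ℂ)) : dist A⁻¹ A'⁻¹ = dist A A' := by
  rw [Subtype.dist_eq, Subtype.dist_eq, dist_eq_norm, dist_eq_norm]
  show ‖(A : Matrix (Fin N) (Fin N) ℂ)ᴴ - (A' : Matrix (Fin N) (Fin N) ℂ)ᴴ‖ = _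
  rw [← Matrix.conjTranspose_sub, Matrix.frobenius_norm_conjTranspose]

variable {d L : ℕ}

/-- **Plaquettes are `1`-Lipschitz in each of their four links**:
`dist (U_p) (V_p) ≤ Σ_{e ∈ ∂p} dist (U e) (V e)` (written out for the four links). [folklore] -/
theorem dist_plaquetteHolonomy_le (U V : GaugeConfig d L (Matrix.specialUnitaryGroup (Fin N) ℂ)) (x : Site d L) (μ ν : Fin d) :
    dist (plaquetteHolonomy U x μ ν) (plaquetteHolonomy V x μ ν) ≤
      dist (U (x, μ)) (V (x, μ)) + dist (U (x.shift μ, ν)) (V (x.shift μ, ν)) +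
        dist (U (x.shift ν, μ)) (V (x.shift ν, μ)) + dist (U (x, ν)) (V (x, ν)) := by
  unfold plaquetteHolonomy
  calc dist (U (x, μ) * U (x.shift μ, ν) * (U (x.shift ν, μ))⁻¹ * (U (x, ν))⁻¹)
        (V (x, μ) * V (x.shift μ, ν) * (V (x.shift ν, μ))⁻¹ * (V (x, ν))⁻¹)
      ≤ dist (U (x, μ) * U (x.shift μ, ν) * (U (x.shift ν, μ))⁻¹)
          (V (x, μ) * V (x.shift μ, ν) * (V (x.shift ν, μ))⁻¹) +
          dist (U (x, ν))⁻¹ (V (x, ν))⁻¹ := dist_mul_mul_le _ _ _ _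
    _ ≤ dist (U (x, μ) * U (x.shift μ, ν)) (V (x, μ) * V (x.shift μ, ν)) +
          dist (U (x.shift ν, μ))⁻¹ (V (x.shift ν, μ))⁻¹ + dist (U (x, ν))⁻¹ (V (x, ν))⁻¹ := by
        linarith [dist_mul_mul_le (U (x, μ) * U (x.shift μ, ν)) (U (x.shift ν, μ))⁻¹
          (V (x, μ) * V (x.shift μ, ν)) (V (x.shift ν, μ))⁻¹]
    _ ≤ _ := by
        rw [dist_inv_inv_eq, dist_inv_inv_eq]
        linarith [dist_mul_mul_le (U (x, μ)) (U (x.shift μ, ν)) (V (x, μ)) (V (x.shift μ, ν))]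

/-! ## §3 The `SU(N)` molecular-dynamics drift and its momentum collar -/

/-- **The MD drift** with momenta `ϖ : E → 𝔰𝔲(N)` for time `t`: `U_e ↦ exp(t·ϖ_e)·U_e`. [folklore] -/
def drift (t : ℝ) (ϖ : Edge d L → suAlg N) (U : GaugeConfig d L (Matrix.specialUnitaryGroup (Fin N) ℂ)) : GaugeConfig d L (Matrix.specialUnitaryGroup (Fin N) ℂ) :=
  fun e => suChart (t • ϖ e) * U e

/-- The drift at time `0` is the identity. [folklore] -/
theorem drift_zero (ϖ : Edge d L → suAlg N) (U : GaugeConfig d L (Matrix.specialUnitaryGroup (Fin N) ℂ)) : drift 0 ϖ U = U := by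
  funext e; simp [drift, suChart_zero]

/-- **Each link moves at speed at most `‖ϖ_e‖`**: `dist ((drift t ϖ U) e) (U e) ≤ |t|·‖ϖ e‖`. [folklore] -/
theorem dist_drift_apply_le (t : ℝ) (ϖ : Edge d L → suAlg N) (U : GaugeConfig d L (Matrix.specialUnitaryGroup (Fin N) ℂ)) (e : Edge d L) :
    dist (drift t ϖ U e) (U e) ≤ |t| * ‖ϖ e‖ := by
  have hU : ((U e : (Matrix.specialUnitaryGroup (Fin N) ℂ)) : Matrix (Fin N) (Fin N) ℂ) ∈ Matrix.unitaryGroup (Fin N) ℂ :=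
    Matrix.specialUnitaryGroup_le_unitaryGroup (U e).2
  set X : Matrix (Fin N) (Fin N) ℂ := skewOf ((ϖ e : suAlg N) : 𝔼 N) with hX
  have hXskew : Xᴴ = -X := conjTranspose_skewOf _
  have hXn : ‖X‖ = ‖ϖ e‖ := by rw [hX, LinearIsometry.norm_map, Submodule.norm_coe]
  rw [Subtype.dist_eq, dist_eq_norm]
  have e1 : ((drift t ϖ U e : (Matrix.specialUnitaryGroup (Fin N) ℂ)) : Matrix (Fin N) (Fin N) ℂ) - ((U e : (Matrix.specialUnitaryGroup (Fin N) ℂ)) : Matrix (Fin N) (Fin N) ℂ) =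
      (exp (t • X) - 1) *
        ((⟨((U e : (Matrix.specialUnitaryGroup (Fin N) ℂ)) : Matrix (Fin N) (Fin N) ℂ), hU⟩ : Matrix.unitaryGroup (Fin N) ℂ) :
          Matrix (Fin N) (Fin N) ℂ) := by
    show exp (skewOf ((t • ϖ e : suAlg N) : 𝔼 N)) * ((U e : (Matrix.specialUnitaryGroup (Fin N) ℂ)) : Matrix (Fin N) (Fin N) ℂ) - (U e : (Matrix.specialUnitaryGroup (Fin N) ℂ)) =
      (exp (t • X) - 1) * ((U e : (Matrix.specialUnitaryGroup (Fin N) ℂ)) : Matrix (Fin N) (Fin N) ℂ)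
    rw [Submodule.coe_smul, map_smul, Matrix.sub_mul, Matrix.one_mul]
  rw [e1, Matrix.frobenius_norm_mul_unitaryGroup, ← hXn]
  exact norm_exp_smul_sub_one_le_abs_mul hXskew t

/-- **Plaquette displacement under the drift**: every plaquette moves by at most `|t|` times the sum
of the momentum norms on its four links. [folklore] -/
theorem dist_plaquetteHolonomy_drift_le (t : ℝ) (ϖ : Edge d L → suAlg N) (U : GaugeConfig d L (Matrix.specialUnitaryGroup (Fin N) ℂ))
    (x : Site d L) (μ ν : Fin d) :
    dist (plaquetteHolonomy (drift t ϖ U) x μ ν) (plaquetteHolonomy U x μ ν) ≤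
      |t| * (‖ϖ (x, μ)‖ + ‖ϖ (x.shift μ, ν)‖ + ‖ϖ (x.shift ν, μ)‖ + ‖ϖ (x, ν)‖) := by
  have h := dist_plaquetteHolonomy_le (drift t ϖ U) U x μ ν
  have h1 := dist_drift_apply_le t ϖ U (x, μ)
  have h2 := dist_drift_apply_le t ϖ U (x.shift μ, ν)
  have h3 := dist_drift_apply_le t ϖ U (x.shift ν, μ)
  have h4 := dist_drift_apply_le t ϖ U (x, ν)
  nlinarith [h, h1, h2, h3, h4, abs_nonneg t]

/-- The drift is continuous in time. [folklore] -/
theorem continuous_drift_time (ϖ : Edge d L → suAlg N) (U : GaugeConfig d L (Matrix.specialUnitaryGroup (Fin N) ℂ)) :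
    Continuous fun t : ℝ => drift t ϖ U := by
  refine continuous_pi fun e => ?_
  exact ((continuous_suChart.comp (continuous_id.smul continuous_const)).mul continuous_const)

/-- **THE MOMENTUM COLLAR (charge-free, every `N`, `d`, `L`).**  Let the admissible region `A` contain
every configuration all of whose plaquettes are within Hilbert–Schmidt distance `ε` of `1` (e.g.
`A = {∀ p, dist (U_p) 1 < ε}` itself, Lüscher's `ε`-admissible set).  If the drift for time `δ` moves
`U` out of its SECTOR (the connected component of `A` containing it), then at the START some
plaquette is already within `|δ|·Σ_{e∈∂p}‖ϖ_e‖` of the defect level: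
`ε − |δ|·(‖ϖ‖ summed over ∂p) ≤ dist (U_p) 1`. [folklore] -/
theorem exists_plaquette_near_defect_of_sector_ne {ε δ : ℝ} {A : Set (GaugeConfig d L (Matrix.specialUnitaryGroup (Fin N) ℂ))}
    (hA : ∀ V : GaugeConfig d L (Matrix.specialUnitaryGroup (Fin N) ℂ), (∀ x μ ν, dist (plaquetteHolonomy V x μ ν) 1 < ε) → V ∈ A)
    (ϖ : Edge d L → suAlg N) (U : GaugeConfig d L (Matrix.specialUnitaryGroup (Fin N) ℂ))
    (hne : connectedComponentIn A (drift δ ϖ U) ≠ connectedComponentIn A U) :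
    ∃ (x : Site d L) (μ ν : Fin d),
      ε - |δ| * (‖ϖ (x, μ)‖ + ‖ϖ (x.shift μ, ν)‖ + ‖ϖ (x.shift ν, μ)‖ + ‖ϖ (x, ν)‖) ≤
        dist (plaquetteHolonomy U x μ ν) 1 := by
  by_contra hcon
  push Not at hcon
  -- then the whole drift segment `t ∈ [0,1] ↦ drift (tδ) ϖ U` stays inside `A`
  have hseg : ∀ t ∈ Icc (0 : ℝ) 1, drift (t * δ) ϖ U ∈ A := by
    intro t ht
    refine hA _ fun x μ ν => ?_
    have hd := dist_plaquetteHolonomy_drift_le (t * δ) ϖ U x μ ν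
    have hc := hcon x μ ν
    have htδ : |t * δ| ≤ |δ| := by
      rw [abs_mul, abs_of_nonneg ht.1]
      exact mul_le_of_le_one_left (abs_nonneg δ) ht.2
    have hsum : 0 ≤ ‖ϖ (x, μ)‖ + ‖ϖ (x.shift μ, ν)‖ + ‖ϖ (x.shift ν, μ)‖ + ‖ϖ (x, ν)‖ := by
      positivity
    have htri := dist_triangle (plaquetteHolonomy (drift (t * δ) ϖ U) x μ ν)
      (plaquetteHolonomy U x μ ν) 1
    have hm := mul_le_mul_of_nonneg_right htδ hsum
    linarith
  -- the segment is preconnected, contains `U` (`t = 0`) and `drift δ ϖ U` (`t = 1`)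
  have hγ : Continuous fun t : ℝ => drift (t * δ) ϖ U :=
    (continuous_drift_time ϖ U).comp (continuous_id.mul continuous_const)
  have himg : (fun t : ℝ => drift (t * δ) ϖ U) '' Icc (0 : ℝ) 1 ⊆ A := by
    rintro _ ⟨t, ht, rfl⟩; exact hseg t ht
  have hpre : IsPreconnected ((fun t : ℝ => drift (t * δ) ϖ U) '' Icc (0 : ℝ) 1) :=
    isPreconnected_Icc.image _ hγ.continuousOn
  have h0 : U ∈ (fun t : ℝ => drift (t * δ) ϖ U) '' Icc (0 : ℝ) 1 :=
    ⟨0, left_mem_Icc.2 zero_le_one, by simp only [zero_mul, drift_zero]⟩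
  have h1 : drift δ ϖ U ∈ (fun t : ℝ => drift (t * δ) ϖ U) '' Icc (0 : ℝ) 1 :=
    ⟨1, right_mem_Icc.2 zero_le_one, by simp only [one_mul]⟩
  have hmem : drift δ ϖ U ∈ connectedComponentIn A U :=
    (hpre.subset_connectedComponentIn h0 himg) h1
  exact hne (connectedComponentIn_eq hmem).symm


/-! ## §4 The `SU(N)` HMC sector tunnelling law -/

section Law

variable [NeZero L]

/-- The Hilbert–Schmidt distance of a plaquette to `1` is a measurable function of the
configuration. [folklore] -/
theorem measurable_plaquetteDist (x : Site d L) (μ ν : Fin d) :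
    Measurable fun U : GaugeConfig d L (Matrix.specialUnitaryGroup (Fin N) ℂ) => dist (plaquetteHolonomy U x μ ν) 1 := by
  have hc : Continuous fun U : GaugeConfig d L (Matrix.specialUnitaryGroup (Fin N) ℂ) => plaquetteHolonomy U x μ ν := by
    unfold plaquetteHolonomy; fun_prop
  exact (hc.dist continuous_const).measurable

omit [NeZero L] in
/-- The momentum margin of a plaquette is a measurable function of the phase point. [folklore] -/
theorem measurable_driftMargin {M : Type*} [MeasurableSpace M] {g : M → (Edge d L → suAlg N)}
    (hg : Measurable g) (δ : ℝ) (x : Site d L) (μ ν : Fin d) :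
    Measurable fun m : M =>
      |δ| * (‖g m (x, μ)‖ + ‖g m (x.shift μ, ν)‖ + ‖g m (x.shift ν, μ)‖ + ‖g m (x, ν)‖) := by
  have h : ∀ e : Edge d L, Measurable fun m : M => ‖g m e‖ := fun e =>
    ((measurable_pi_apply e).comp hg).norm
  exact ((((h _).add (h _)).add (h _)).add (h _)).const_mul _

/-- The `SU(N)` momentum-collar event of phase space is measurable. [folklore] -/
theorem measurableSet_sunCollarAt {M : Type*} [MeasurableSpace M]
    {g : GaugeConfig d L (Matrix.specialUnitaryGroup (Fin N) ℂ) × M → (Edge d L → suAlg N)} (hg : Measurable g) (ε δ : ℝ) :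
    MeasurableSet {z : GaugeConfig d L (Matrix.specialUnitaryGroup (Fin N) ℂ) × M | ∃ (x : Site d L) (μ ν : Fin d),
      ε - |δ| * (‖g z (x, μ)‖ + ‖g z (x.shift μ, ν)‖ + ‖g z (x.shift ν, μ)‖ + ‖g z (x, ν)‖) ≤
        dist (plaquetteHolonomy z.1 x μ ν) 1} := by
  have e : {z : GaugeConfig d L (Matrix.specialUnitaryGroup (Fin N) ℂ) × M | ∃ (x : Site d L) (μ ν : Fin d),
      ε - |δ| * (‖g z (x, μ)‖ + ‖g z (x.shift μ, ν)‖ + ‖g z (x.shift ν, μ)‖ + ‖g z (x, ν)‖) ≤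
        dist (plaquetteHolonomy z.1 x μ ν) 1} =
      ⋃ (x : Site d L), ⋃ (μ : Fin d), ⋃ (ν : Fin d), {z | ε - |δ| * (‖g z (x, μ)‖ +
        ‖g z (x.shift μ, ν)‖ + ‖g z (x.shift ν, μ)‖ + ‖g z (x, ν)‖) ≤
          dist (plaquetteHolonomy z.1 x μ ν) 1} := by
    ext z; simp only [mem_setOf_eq, mem_iUnion]
  rw [e]
  refine MeasurableSet.iUnion fun x => MeasurableSet.iUnion fun μ => MeasurableSet.iUnion fun ν => ?_
  exact measurableSet_le (measurable_const.sub (measurable_driftMargin hg δ x μ ν))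
    ((measurable_plaquetteDist x μ ν).comp measurable_fst)

/-- **THE `SU(N)` HMC SECTOR TUNNELLING LAW.**  Target `e^{-S}volU` on `SU(N)^E` for ANY measurable
action `S` and any s-finite `volU`, momenta on any measurable space `M` with kinetic term `T`,
`0 < Z_T < ∞`, law `Z_T⁻¹e^{-T}volP`; proposal `Φ = flip ∘ (nodes step n)` with `volU ⊗ volP`-preserving
steps whose configuration component is an `SU(N)` MD drift by a measurable momentum field `g k` for
time `δ k` (kicks: `g k = 0`), `flip` not touching the configuration; Metropolis filter on `H = S + T`
— the kernel of `Exactness.hmc_config_exact`.  Let `A` contain every configuration all of whose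
plaquettes are within `ε` of `1`, and let `Q` be measurable and CONSTANT ON THE SECTORS (connected
components) of `A`.  Then for every `h : ℝ`, per update at stationarity,
`(e^{-S}volU ⊗ K){Q ≠ Q'} ≤ Z_T⁻¹ Σ_{k<n} (e^{h}·B{z | ∃ p, ε − |δ_k|·Σ_{e∈∂p}‖(g_k z)_e‖ ≤ dist ((z.1)_p) 1}
 + B{ΔH_k > h})`, `B = e^{-(S+T)}(volU ⊗ volP)`. [folklore] -/
theorem sun_hmc_sectorCharge_ne_le_sum {ε : ℝ} {A : Set (GaugeConfig d L (Matrix.specialUnitaryGroup (Fin N) ℂ))}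
    (hA : ∀ V : GaugeConfig d L (Matrix.specialUnitaryGroup (Fin N) ℂ), (∀ x μ ν, dist (plaquetteHolonomy V x μ ν) 1 < ε) → V ∈ A)
    {Q : GaugeConfig d L (Matrix.specialUnitaryGroup (Fin N) ℂ) → ℝ} (hQ : Measurable Q)
    (hQA : ∀ U V : GaugeConfig d L (Matrix.specialUnitaryGroup (Fin N) ℂ), V ∈ connectedComponentIn A U → Q V = Q U)
    {M : Type*} [MeasurableSpace M]
    (volU : Measure (GaugeConfig d L (Matrix.specialUnitaryGroup (Fin N) ℂ))) (volP : Measure M) [SFinite volU] [SFinite volP]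
    {S : GaugeConfig d L (Matrix.specialUnitaryGroup (Fin N) ℂ) → ℝ} (hS : Measurable S) {T : M → ℝ} (hT : Measurable T)
    {step : ℕ → GaugeConfig d L (Matrix.specialUnitaryGroup (Fin N) ℂ) × M → GaugeConfig d L (Matrix.specialUnitaryGroup (Fin N) ℂ) × M}
    (hstep : ∀ k, MeasurePreserving (step k) (volU.prod volP) (volU.prod volP))
    (δ : ℕ → ℝ) {g : ℕ → GaugeConfig d L (Matrix.specialUnitaryGroup (Fin N) ℂ) × M → (Edge d L → suAlg N)} (hg : ∀ k, Measurable (g k))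
    (hdrift : ∀ k z, (step k z).1 = drift (δ k) (g k z) z.1)
    {flip : GaugeConfig d L (Matrix.specialUnitaryGroup (Fin N) ℂ) × M → GaugeConfig d L (Matrix.specialUnitaryGroup (Fin N) ℂ) × M} (hflip : ∀ z, (flip z).1 = z.1)
    (n : ℕ) {Φ : GaugeConfig d L (Matrix.specialUnitaryGroup (Fin N) ℂ) × M → GaugeConfig d L (Matrix.specialUnitaryGroup (Fin N) ℂ) × M} (hΦ : Measurable Φ)
    (hΦeq : ∀ z, Φ z = flip (MD.nodes step n z))
    (hZ0 : volP.withDensity (fun π => ENNReal.ofReal (Real.exp (-T π))) Set.univ ≠ 0)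
    (hZtop : volP.withDensity (fun π => ENNReal.ofReal (Real.exp (-T π))) Set.univ ≠ ∞) (h : ℝ) :
    (MD.boltz volU S ⊗ₘ
        refreshUpdate (involMH Φ hΦ fun z : GaugeConfig d L (Matrix.specialUnitaryGroup (Fin N) ℂ) × M => S z.1 + T z.2)
          ((volP.withDensity (fun π => ENNReal.ofReal (Real.exp (-T π))) Set.univ)⁻¹ •
            volP.withDensity fun π => ENNReal.ofReal (Real.exp (-T π))))
      {q | Q q.1 ≠ Q q.2} ≤
      (volP.withDensity (fun π => ENNReal.ofReal (Real.exp (-T π))) Set.univ)⁻¹ *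
        ∑ k ∈ Finset.range n,
          (ENNReal.ofReal (Real.exp h) *
              MD.boltz (volU.prod volP) (fun z => S z.1 + T z.2)
                {z | ∃ (x : Site d L) (μ ν : Fin d),
                  ε - |δ k| * (‖g k z (x, μ)‖ + ‖g k z (x.shift μ, ν)‖ + ‖g k z (x.shift ν, μ)‖ +
                    ‖g k z (x, ν)‖) ≤ dist (plaquetteHolonomy z.1 x μ ν) 1} +
            MD.boltz (volU.prod volP) (fun z => S z.1 + T z.2)
              {z | h < (S (MD.nodes step k z).1 + T (MD.nodes step k z).2) - (S z.1 + T z.2)}) := by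
  refine MD.hmc_chargeNe_le_sum volU volP hS hT hstep hflip n hΦ hΦeq hQ
    (fun k => {z | ∃ (x : Site d L) (μ ν : Fin d),
      ε - |δ k| * (‖g k z (x, μ)‖ + ‖g k z (x.shift μ, ν)‖ + ‖g k z (x.shift ν, μ)‖ +
        ‖g k z (x, ν)‖) ≤ dist (plaquetteHolonomy z.1 x μ ν) 1})
    (fun k => measurableSet_sunCollarAt (hg k) ε (δ k)) (fun k z hne => ?_) hZ0 hZtop h
  -- a change of the sector-constant `Q` under the drift is a change of sector, or a start outside `A`
  rw [hdrift] at hne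
  by_cases hcomp : connectedComponentIn A (drift (δ k) (g k z) z.1) = connectedComponentIn A z.1
  · -- same sector label: then `z.1 ∉ A` (else `Q` would agree), so some plaquette is already `≥ ε` away
    have hzA : z.1 ∉ A := by
      intro hzA
      have hmem : z.1 ∈ connectedComponentIn A (drift (δ k) (g k z) z.1) := by
        rw [hcomp]; exact mem_connectedComponentIn hzA
      exact hne (hQA _ _ hmem).symm
    have hnot : ¬ ∀ x μ ν, dist (plaquetteHolonomy z.1 x μ ν) 1 < ε := fun hall => hzA (hA _ hall)
    push Not at hnot
    obtain ⟨x, μ, ν, hx⟩ := hnot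
    refine ⟨x, μ, ν, le_trans ?_ hx⟩
    have : 0 ≤ |δ k| * (‖g k z (x, μ)‖ + ‖g k z (x.shift μ, ν)‖ + ‖g k z (x.shift ν, μ)‖ +
        ‖g k z (x, ν)‖) := by positivity
    linarith
  · exact exists_plaquette_near_defect_of_sector_ne hA (g k z) z.1 hcomp

end Law

end Summit.Ventures.LatticeQCDFlow.Theory2.Lattice.SUN

end
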